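import Summits.ResolutionOfSingularities.ResolutionOfSingularities.Theorems.FrobeniusClosingSteerK7HatFibreSquares
import Summits.ResolutionOfSingularities.ResolutionOfSingularities.Theorems.FrobeniusClosingSteerK7HatOrderTwoDescent
import Summits.ResolutionOfSingularities.ResolutionOfSingularities.Theorems.FrobeniusClosingSteerRadicandSingularCriterion
import Literature.AlgebraicGeometry.Resolution.GRingPrimeExtension
import Literature.AlgebraicGeometry.Resolution.LogRegularCompleteStructure
import Mathlib.RingTheory.LocalRing.ResidueField.Fiber
import HarnessLib

/-!
# Crux `Steer` (stmt-ResolutionOfSingularities-16345), chain W4.1 — K-β7-hat W1 `BranchTransfer`, FILE 3: the centre `Q₀ = P₁ ∩ S` is a curve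

OURS (campaign `res-hironaka`, rung L ★L-G4, slot W4.1; res-L0-w41-idea-3 g12, object of record W1 by res-L0-w41-plan-1 RULINGS 237(b)/242(c)/256(b);
plan `L/res-L0-w41-idea-3/k7w1/W1-PLAN.md` bc52383b129f540e §1 (G1)+(G2)+(C), §2 row 3). Def-free kernel piece №3 of the proof of the tree word
`…Theorems.SwitchingDichotomy.K7Hat.BranchTransfer` (p555432): the HEIGHT of the contracted centre. Replaces the role of no printed item; NOT a statement
of the manuscript under review [claim: Hironaka2017, status: under-review]; AI-produced, weaker than expert review; counted 0.

SETTING. `S → T` a regular homomorphism (flat, geometrically regular fibres) from a regular local ring `S` of characteristic `2` to a Noetherian local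
ring `T`; `P₁ ⊂ T` prime, `Q₀ := P₁ ∩ S`; `y ∈ 𝔪_S` with `y ∉ P₁`; `F ∈ S`, `q ∈ T` with `F + q² ∈ P₁²`; and the β-leaf clause «no singular surface»:
every prime `Q` of `S` over which the torsor `X² = F` is singular has `dim S/Q ≤ 1`.

`ringKrullDim_quotient_under_eq_one`: then `dim S/Q₀ = 1`. PROOF (W1-PLAN §1). (G1) The fibre of `S → T` over `Q₀` is geometrically regular, so by
FILE 1's `K7HatFibreSquares.residue_eq_sq_of_fiber` (p557918) the residue of `F` in `κ(Q₀)` is a square `c̄²`; lift `c ∈ A := S_{Q₀}` and put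
`g := F − c² ∈ 𝔪_A`. In `B := T_{P₁}` (characteristic `2`): `(q + c)² = (F + q²) − (F − c²) ∈ 𝔪_B`, so `q + c ∈ 𝔪_B`, and then
`F − c² = (F + q²) + (q + c)² − 2(…) ∈ 𝔪_B²`. (G2) `A → B` is flat local with regular closed fibre (tree
`IsRegularHom.isRegularLocalRing_localization_quotient_map_under`), so FILE 2's `K7HatOrderTwoDescent.mem_sq_of_algebraMap_mem_sq` (p557552) gives
`g ∈ 𝔪_A²`. (C) By the tree criterion `RadicandSingular.not_isRegularLocalRing_adjoinRoot_atPrime_iff` the torsor is singular over `Q₀`, so the clause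
gives `dim S/Q₀ ≤ 1`; and `y ∈ 𝔪_S ∖ Q₀` gives `Q₀ ≠ 𝔪_S`, `dim S/Q₀ ≥ 1`. [cite: Matsumura1987, Thm. 14.2, Thm. 23.7, §32 p. 256] [folklore]
bears_on: LADDER-RESOLUTION L ★L-G4 W4.1 (crux `Steer`, β-leaf binder hβ6′ `FormalCentreDescent`, crux piece W1 `BranchTransfer`).
-/

noncomputable section

set_option linter.dupNamespace false
set_option autoImplicit false

open IsLocalRing Polynomial


namespace Summit.ResolutionOfSingularities.ResolutionOfSingularities.Theorems.SwitchingDichotomy.K7HatCentreCurve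

open Literature.AlgebraicGeometry.Resolution
open Summit.ResolutionOfSingularities.ResolutionOfSingularities.Theorems.SwitchingDichotomy

universe u

/-- A prime `𝔭 ≠ 𝔪` of a local ring has `1 ≤ dim R ⧸ 𝔭` (the chain `𝔭 < 𝔪`; same proof as the treeʼs
`BetaLegality.one_le_ringKrullDim_quotient_of_ne_maximalIdeal`, restated universe-polymorphically to keep the import cone small). [folklore] -/
theorem one_le_ringKrullDim_quotient_of_ne_maximalIdeal {R : Type u} [CommRing R] [IsLocalRing R] (P : Ideal R)
    [hP : P.IsPrime] (hne : P ≠ maximalIdeal R) : (1 : WithBot ℕ∞) ≤ ringKrullDim (R ⧸ P) := by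
  have hlt : P < maximalIdeal R := lt_of_le_of_ne (IsLocalRing.le_maximalIdeal hP.ne_top) hne
  have h0 : ((0 : ℕ) : WithBot ℕ∞) ≤ ringKrullDim (R ⧸ maximalIdeal R) := by
    haveI : Nontrivial (R ⧸ maximalIdeal R) := Ideal.Quotient.nontrivial_iff.mpr (maximalIdeal.isMaximal R).ne_top
    exact_mod_cast ringKrullDim_nonneg_of_nontrivial
  have := LogRegularCompleteStructure.succ_le_ringKrullDim_quotient_of_lt hlt 0 h0
  simpa using this

/-- **The contracted centre is a curve (steps (G1)+(G2)+(C) of W1).** See the module docstring.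
[cite: Matsumura1987, Thm. 14.2, Thm. 23.7, §32 p. 256] [folklore] -/
theorem ringKrullDim_quotient_under_eq_one {S T : Type u} [CommRing S] [CommRing T] [IsLocalRing T] [IsNoetherianRing T]
    [Algebra S T] [CharP S 2] (hreg : IsRegularLocalRing S) (hRH : IsRegularHom S T)
    (P₁ : Ideal T) [P₁.IsPrime] (y F : S) (q : T) (hy : y ∈ maximalIdeal S) (hyP : algebraMap S T y ∉ P₁)
    (hF : algebraMap S T F + q ^ 2 ∈ P₁ ^ 2)
    (hNS : ∀ (Q : Ideal S) [Q.IsPrime],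
      ¬ IsRegularLocalRing (AdjoinRoot (X ^ 2 - C (algebraMap S (Localization.AtPrime Q) F))) → ringKrullDim (S ⧸ Q) ≤ 1) :
    ringKrullDim (S ⧸ P₁.under S) = 1 := by
  classical
  haveI := hreg
  haveI : Fact (Nat.Prime 2) := ⟨Nat.prime_two⟩
  -- `dim S/Q₀ ≥ 1`: `y ∈ 𝔪_S ∖ Q₀`
  have hne : P₁.under S ≠ maximalIdeal S := fun h => hyP (Ideal.mem_comap.mp (h ▸ hy : y ∈ P₁.under S))
  refine le_antisymm (hNS (P₁.under S) ?_) (one_le_ringKrullDim_quotient_of_ne_maximalIdeal _ hne)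
  -- `dim S/Q₀ ≤ 1`: the torsor `X² = F` is singular over `Q₀`
  haveI : IsRegularLocalRing (Localization.AtPrime (P₁.under S)) := isRegularLocalRing_localization_atPrime S _
  haveI : CharP (Localization.AtPrime (P₁.under S)) 2 :=
    K7HatFibreSquares.charP_two_of_algebra (A := S) (Localization.AtPrime (P₁.under S))
  rw [RadicandSingular.not_isRegularLocalRing_adjoinRoot_atPrime_iff 2 (P₁.under S) F]
  -- the local map `A := S_{Q₀} → B := T_{P₁}`
  letI : Algebra (Localization.AtPrime (P₁.under S)) (Localization.AtPrime P₁) :=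
    Localization.AtPrime.algebraOfLiesOver (P₁.under S) P₁
  haveI : IsLocalHom (algebraMap (Localization.AtPrime (P₁.under S)) (Localization.AtPrime P₁)) := by
    rw [Localization.AtPrime.IsLiesOverAlgebra.algebraMap_eq (p := P₁.under S) (P := P₁)]
    infer_instance
  haveI : Module.Flat S T := hRH.1
  haveI : Module.Flat S (Localization.AtPrime P₁) := Module.Flat.trans S T (Localization.AtPrime P₁)
  haveI : Module.Flat (Localization.AtPrime (P₁.under S)) (Localization.AtPrime P₁) :=
    (Module.flat_iff_of_isLocalization (Localization.AtPrime (P₁.under S)) (P₁.under S).primeCompl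
      (Localization.AtPrime P₁)).mpr ‹_›
  haveI : CharP (Localization.AtPrime P₁) 2 := K7HatFibreSquares.charP_two_of_algebra (A := S) (Localization.AtPrime P₁)
  have h2B : (2 : Localization.AtPrime P₁) = 0 := by simpa using CharP.cast_eq_zero (Localization.AtPrime P₁) 2
  -- its closed fibre is regular
  have hpm : (P₁.under S).map (algebraMap S (Localization.AtPrime P₁)) =
      (maximalIdeal (Localization.AtPrime (P₁.under S))).map
        (algebraMap (Localization.AtPrime (P₁.under S)) (Localization.AtPrime P₁)) := by
    rw [← Localization.AtPrime.map_eq_maximalIdeal, Ideal.map_map, ← IsScalarTower.algebraMap_eq]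
  haveI := IsRegularHom.isRegularLocalRing_localization_quotient_map_under hRH P₁
  have hfib : IsRegularLocalRing (Localization.AtPrime P₁ ⧸
      (maximalIdeal (Localization.AtPrime (P₁.under S))).map
        (algebraMap (Localization.AtPrime (P₁.under S)) (Localization.AtPrime P₁))) :=
    IsRegularLocalRing.of_ringEquiv
      (R := Localization.AtPrime P₁ ⧸ (P₁.under S).map (algebraMap S (Localization.AtPrime P₁)))
      (Ideal.quotEquivOfEq hpm)
  -- (G1) the residue of `F` in `κ(Q₀)` is a square; lift it to `c ∈ A`
  have hgeo : IsGeometricallyRegular (P₁.under S).ResidueField ((P₁.under S).Fiber T) := hRH.2 (P₁.under S)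
  obtain ⟨cbar, hcbar⟩ := K7HatFibreSquares.residue_eq_sq_of_fiber (P₁.under S) hgeo P₁ F q hF
  obtain ⟨c, hc⟩ : ∃ c : Localization.AtPrime (P₁.under S), IsLocalRing.residue _ c = cbar :=
    Ideal.Quotient.mk_surjective cbar
  refine ⟨c, ?_⟩
  -- `g := F − c² ∈ 𝔪_A`
  have hg1 : algebraMap S (Localization.AtPrime (P₁.under S)) F - c ^ 2 ∈ maximalIdeal (Localization.AtPrime (P₁.under S)) := by
    have hres : IsLocalRing.residue _ (algebraMap S (Localization.AtPrime (P₁.under S)) F) =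
        algebraMap S (P₁.under S).ResidueField F := by
      rw [← IsLocalRing.ResidueField.algebraMap_eq, ← IsScalarTower.algebraMap_apply]
    rw [← IsLocalRing.residue_eq_zero_iff, map_sub, map_pow, hc, hres, hcbar, sub_self]
  -- `g ↦ 𝔪_B²` (characteristic-2 bookkeeping in `B`)
  have hFB : algebraMap (Localization.AtPrime (P₁.under S)) (Localization.AtPrime P₁)
      (algebraMap S (Localization.AtPrime (P₁.under S)) F) =
      algebraMap T (Localization.AtPrime P₁) (algebraMap S T F) := by
    rw [← IsScalarTower.algebraMap_apply, ← IsScalarTower.algebraMap_apply]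
  have hFq : algebraMap T (Localization.AtPrime P₁) (algebraMap S T F) + (algebraMap T (Localization.AtPrime P₁) q) ^ 2 ∈
      maximalIdeal (Localization.AtPrime P₁) ^ 2 := by
    have := Ideal.mem_map_of_mem (algebraMap T (Localization.AtPrime P₁)) hF
    rw [Ideal.map_pow, Localization.AtPrime.map_eq_maximalIdeal, map_add, map_pow] at this
    exact this
  have hgB : algebraMap (Localization.AtPrime (P₁.under S)) (Localization.AtPrime P₁)
      (algebraMap S (Localization.AtPrime (P₁.under S)) F - c ^ 2) =
      algebraMap T (Localization.AtPrime P₁) (algebraMap S T F) -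
        (algebraMap (Localization.AtPrime (P₁.under S)) (Localization.AtPrime P₁) c) ^ 2 := by
    rw [map_sub, map_pow, hFB]
  have hgm : algebraMap T (Localization.AtPrime P₁) (algebraMap S T F) -
      (algebraMap (Localization.AtPrime (P₁.under S)) (Localization.AtPrime P₁) c) ^ 2 ∈
      maximalIdeal (Localization.AtPrime P₁) :=
    hgB ▸ map_nonunit (algebraMap (Localization.AtPrime (P₁.under S)) (Localization.AtPrime P₁)) _ hg1
  have hqc : algebraMap T (Localization.AtPrime P₁) q +
      algebraMap (Localization.AtPrime (P₁.under S)) (Localization.AtPrime P₁) c ∈ maximalIdeal (Localization.AtPrime P₁) := by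
    refine Ideal.IsPrime.mem_of_pow_mem inferInstance 2 ?_
    have hid : (algebraMap T (Localization.AtPrime P₁) q +
        algebraMap (Localization.AtPrime (P₁.under S)) (Localization.AtPrime P₁) c) ^ 2 =
        (algebraMap T (Localization.AtPrime P₁) (algebraMap S T F) + (algebraMap T (Localization.AtPrime P₁) q) ^ 2) -
          (algebraMap T (Localization.AtPrime P₁) (algebraMap S T F) -
            (algebraMap (Localization.AtPrime (P₁.under S)) (Localization.AtPrime P₁) c) ^ 2) +
          2 * (algebraMap T (Localization.AtPrime P₁) q *
            algebraMap (Localization.AtPrime (P₁.under S)) (Localization.AtPrime P₁) c) := by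
      ring
    rw [hid, h2B, zero_mul, add_zero]
    exact sub_mem (Ideal.pow_le_self two_ne_zero hFq) hgm
  have hφg : algebraMap (Localization.AtPrime (P₁.under S)) (Localization.AtPrime P₁)
      (algebraMap S (Localization.AtPrime (P₁.under S)) F - c ^ 2) ∈ maximalIdeal (Localization.AtPrime P₁) ^ 2 := by
    rw [hgB]
    have hid : algebraMap T (Localization.AtPrime P₁) (algebraMap S T F) -
        (algebraMap (Localization.AtPrime (P₁.under S)) (Localization.AtPrime P₁) c) ^ 2 =
        (algebraMap T (Localization.AtPrime P₁) (algebraMap S T F) + (algebraMap T (Localization.AtPrime P₁) q) ^ 2) +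
          (algebraMap T (Localization.AtPrime P₁) q +
            algebraMap (Localization.AtPrime (P₁.under S)) (Localization.AtPrime P₁) c) ^ 2 -
          2 * ((algebraMap T (Localization.AtPrime P₁) q) ^ 2 +
            algebraMap T (Localization.AtPrime P₁) q *
              algebraMap (Localization.AtPrime (P₁.under S)) (Localization.AtPrime P₁) c +
            (algebraMap (Localization.AtPrime (P₁.under S)) (Localization.AtPrime P₁) c) ^ 2) := by
      ring
    rw [hid, h2B, zero_mul, sub_zero]
    exact add_mem hFq (Ideal.pow_mem_pow hqc 2)
  -- (G2) order two descends to `A`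
  exact K7HatOrderTwoDescent.mem_sq_of_algebraMap_mem_sq hfib hφg

end Summit.ResolutionOfSingularities.ResolutionOfSingularities.Theorems.SwitchingDichotomy.K7HatCentreCurve
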